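import Mathlib
import Summits.NavierStokesRegularity.NavierStokesRegularity.Theorems.FilamentSkeletonRssKelvinGateSharpGatePerturb

/-!
# Route `FilamentSkeletonRss` · crux `TransverseReduction1A` (stmt-27414; successor of the aside `TransverseReductionRJ`,
# stmt-21221) — line `kelvin_gate`: GATES ARE OPEN — the perturbed gate as a LINEAR OPERATOR (continuity-method seed)

Helper file (theorems only, `--as helper`).  HONEST FRAMING: analysis bookkeeping for a HYPOTHETICAL filament-type rotating
self-similar blow-up route; nothing here bears on Navier–Stokes regularity; no stub is proved here.

`…SharpGatePerturb.gatePerturb_exists_fixedPoint/unique` solve `G = F − (D(KG)[V] + DV[KG])` for each datum `F`.  Here the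
solution is packaged as an OPERATOR: from a gate `K` at some base (operator bound `A` between the sharp scales, linear on
sharp-Y-bounded data) and a `C²` base increment `V` of size `M` with `8AM ≤ 1` we build `K′` with

* operator bound `2A`:  `YSharp a F R → XSharp a (K′ F) (2AR)`;
* linearity on sharp-Y-bounded data;
* the PERTURBED GATE IDENTITY: `K′ F = K G` for a `G` with `YSharp a G (2R)` and `G + (D(K′F)[V] + DV[K′F]) = F` — so if `K` inverts
  `𝓛_(α,U⁰) + ∇𝒬` on `Y♯_a` then `K′` inverts `𝓛_(α,U⁰+V) + ∇𝒬∘fix` (`lerayLin_add_base`).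

(`sharp_gate_open`.)  Iterating this along a path of bases is the continuity method; each step halves the admissible increment
(`A ↦ 2A`), so reaching the crux's `O(Γ)` base needs the a-priori bound that only the Kelvin-mode analysis can give — not here.
-/

set_option linter.dupNamespace false

noncomputable section

namespace Summit.NavierStokesRegularity.NavierStokesRegularity.Theorems.KelvinGate

open Set Function Filter MeasureTheory
open Literature.Analysis.FluidPDE
open scoped InnerProductSpace Laplacian ContDiff Topology

section GateOpen

variable {a : ℝ} {K : (EuclideanSpace ℝ (Fin 3) → EuclideanSpace ℝ (Fin 3)) →
    EuclideanSpace ℝ (Fin 3) → EuclideanSpace ℝ (Fin 3)} {A M : ℝ}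
  {V : EuclideanSpace ℝ (Fin 3) → EuclideanSpace ℝ (Fin 3)}

/-- The perturbation term is linear in the field: for `X♯`-fields `W₁, W₂` (differentiable) and `s ∈ ℝ`,
`D(W₁ + sW₂)[V] + DV[W₁ + sW₂] = (DW₁[V] + DV[W₁]) + s (DW₂[V] + DV[W₂])`. -/
theorem perturbation_add_smul {W₁ W₂ : EuclideanSpace ℝ (Fin 3) → EuclideanSpace ℝ (Fin 3)} {y : EuclideanSpace ℝ (Fin 3)}
    (h₁ : DifferentiableAt ℝ W₁ y) (h₂ : DifferentiableAt ℝ W₂ y) (s : ℝ) :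
    fderiv ℝ (fun z => W₁ z + s • W₂ z) y (V y) + fderiv ℝ V y (W₁ y + s • W₂ y) =
      (fderiv ℝ W₁ y (V y) + fderiv ℝ V y (W₁ y)) + s • (fderiv ℝ W₂ y (V y) + fderiv ℝ V y (W₂ y)) := by
  have h₂' : DifferentiableAt ℝ (fun z => s • W₂ z) y := h₂.const_smul s
  rw [fderiv_fun_add h₁ h₂', fderiv_fun_const_smul h₂]
  simp only [_root_.add_apply, _root_.smul_apply, map_add, map_smul, smul_add]
  abel

/-- **GATES ARE OPEN.**  From a gate `K` (sharp operator bound `A`, linear on sharp-Y-bounded data; `1 ≤ a ≤ 2`) and a `C²`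
base increment `V` with `⟨y⟩‖V‖, ⟨y⟩²‖DV‖, ⟨y⟩³‖D²V‖ ≤ M`, `8AM ≤ 1`: a LINEAR operator `K′` with bound `2A` such that
`K′ F = K G` where `G + (D(K′F)[V] + DV[K′F]) = F`, `YSharp a G (2R)`. -/
theorem sharp_gate_open (ha1 : 1 ≤ a) (ha2 : a ≤ 2)
    (hK1 : ∀ (F : EuclideanSpace ℝ (Fin 3) → EuclideanSpace ℝ (Fin 3)) (R : ℝ), YSharp a F R → XSharp a (K F) (A * R))
    (hK2 : ∀ (F G : EuclideanSpace ℝ (Fin 3) → EuclideanSpace ℝ (Fin 3)) (s : ℝ), (∃ R, YSharp a F R) →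
      (∃ R, YSharp a G R) → K (fun y => F y + s • G y) = fun y => K F y + s • K G y)
    (hV : ContDiff ℝ 2 V) (hV0 : ∀ y, (1 + ‖y‖) * ‖V y‖ ≤ M)
    (hV1 : ∀ y, (1 + ‖y‖) ^ 2 * ‖fderiv ℝ V y‖ ≤ M) (hV2 : ∀ y, (1 + ‖y‖) ^ 3 * ‖fderiv ℝ (fderiv ℝ V) y‖ ≤ M)
    (hAM : 8 * A * M ≤ 1) :
    ∃ K' : (EuclideanSpace ℝ (Fin 3) → EuclideanSpace ℝ (Fin 3)) → EuclideanSpace ℝ (Fin 3) → EuclideanSpace ℝ (Fin 3),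
      (∀ (F : EuclideanSpace ℝ (Fin 3) → EuclideanSpace ℝ (Fin 3)) (R : ℝ), YSharp a F R → XSharp a (K' F) (2 * A * R)) ∧
      (∀ (F G : EuclideanSpace ℝ (Fin 3) → EuclideanSpace ℝ (Fin 3)) (s : ℝ), (∃ R, YSharp a F R) →
        (∃ R, YSharp a G R) → K' (fun y => F y + s • G y) = fun y => K' F y + s • K' G y) ∧
      (∀ (F : EuclideanSpace ℝ (Fin 3) → EuclideanSpace ℝ (Fin 3)) (R : ℝ), YSharp a F R →
        ∃ G : EuclideanSpace ℝ (Fin 3) → EuclideanSpace ℝ (Fin 3), YSharp a G (2 * R) ∧ K' F = K G ∧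
          ∀ y, G y + (fderiv ℝ (K' F) y (V y) + fderiv ℝ V y (K' F y)) = F y) := by
  classical
  -- the fixed-point selector
  let P : (EuclideanSpace ℝ (Fin 3) → EuclideanSpace ℝ (Fin 3)) → (EuclideanSpace ℝ (Fin 3) → EuclideanSpace ℝ (Fin 3)) → Prop :=
    fun F G => (∃ S, YSharp a G S) ∧ ∀ y, G y = F y - (fderiv ℝ (K G) y (V y) + fderiv ℝ V y (K G y))
  let fix : (EuclideanSpace ℝ (Fin 3) → EuclideanSpace ℝ (Fin 3)) → EuclideanSpace ℝ (Fin 3) → EuclideanSpace ℝ (Fin 3) :=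
    fun F => if h : ∃ G, P F G then Classical.choose h else fun _ => 0
  -- for sharp-Y-bounded `F`, `fix F` is THE fixed point, with radius `2R`
  have hfix : ∀ (F : EuclideanSpace ℝ (Fin 3) → EuclideanSpace ℝ (Fin 3)) (R : ℝ), YSharp a F R →
      YSharp a (fix F) (2 * R) ∧ ∀ y, fix F y = F y - (fderiv ℝ (K (fix F)) y (V y) + fderiv ℝ V y (K (fix F) y)) := by
    intro F R hF
    obtain ⟨G₀, hG₀, hG₀fix⟩ := gatePerturb_exists_fixedPoint (K := K) (A := A) ha1 hK1 hK2 hF ha2 hV hV0 hV1 hV2 hAM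
    have hex : ∃ G, P F G := ⟨G₀, ⟨_, hG₀⟩, hG₀fix⟩
    have hch : P F (fix F) := by
      show P F (if h : ∃ G, P F G then Classical.choose h else fun _ => 0)
      rw [dif_pos hex]; exact Classical.choose_spec hex
    obtain ⟨⟨S, hS⟩, hfixeq⟩ := hch
    have heq : fix F = G₀ := gatePerturb_unique (K := K) (A := A) ha1 hK1 hK2 ha2 hV hV0 hV1 hV2 hAM hS hG₀ hfixeq hG₀fix
    refine ⟨heq ▸ hG₀, hfixeq⟩
  refine ⟨fun F => K (fix F), fun F R hF => ?_, fun F G s hF hG => ?_, fun F R hF => ?_⟩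
  · -- bound `2A`
    have h := hK1 _ _ (hfix F R hF).1
    exact h.mono (le_of_eq (by ring))
  · -- linearity: `fix (F + sG) = fix F + s fix G` by uniqueness
    obtain ⟨R, hFR⟩ := hF
    obtain ⟨R', hGR⟩ := hG
    obtain ⟨hfF, hfFeq⟩ := hfix F R hFR
    obtain ⟨hfG, hfGeq⟩ := hfix G R' hGR
    have hsum : YSharp a (fun y => F y + s • G y) (R + |s| * R') := hFR.add (hGR.smul s)
    obtain ⟨hfS, hfSeq⟩ := hfix _ _ hsum
    -- the candidate `H = fix F + s fix G` is a fixed point for `F + sG`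
    have hKlin : K (fun y => fix F y + s • fix G y) = fun y => K (fix F) y + s • K (fix G) y :=
      hK2 _ _ s ⟨_, hfF⟩ ⟨_, hfG⟩
    have hXF : XSharp a (K (fix F)) (A * (2 * R)) := hK1 _ _ hfF
    have hXG : XSharp a (K (fix G)) (A * (2 * R')) := hK1 _ _ hfG
    have hH : YSharp a (fun y => fix F y + s • fix G y) (2 * R + |s| * (2 * R')) := hfF.add (hfG.smul s)
    have hHfix : ∀ y, (fix F y + s • fix G y) = (F y + s • G y) -
        (fderiv ℝ (K (fun z => fix F z + s • fix G z)) y (V y) + fderiv ℝ V y (K (fun z => fix F z + s • fix G z) y)) := by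
      intro y
      rw [hKlin, perturbation_add_smul (hXF.1.differentiable (by norm_num) y) (hXG.1.differentiable (by norm_num) y) s,
        hfFeq y, hfGeq y, smul_sub]
      abel
    have huniq : fix (fun y => F y + s • G y) = fun y => fix F y + s • fix G y :=
      gatePerturb_unique (K := K) (A := A) ha1 hK1 hK2 ha2 hV hV0 hV1 hV2 hAM hfS hH hfSeq hHfix
    show K (fix fun y => F y + s • G y) = fun y => K (fix F) y + s • K (fix G) y
    rw [huniq, hKlin]
  · -- the perturbed gate identity
    obtain ⟨hfF, hfFeq⟩ := hfix F R hF
    refine ⟨fix F, hfF, rfl, fun y => ?_⟩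
    rw [hfFeq y]
    abel

end GateOpen

end Summit.NavierStokesRegularity.NavierStokesRegularity.Theorems.KelvinGate

end
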